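import Summits.HodgeConjecture.HodgeCM.Model.Toy.TwistedTypeNorm_1

/-! PORT of `HodgeCM/Model/Toy/TwistedTypeNorm.lean` (HodgeCMPerL run 82) — part 2: continuation of `Summits.HodgeConjecture.HodgeCM.Model.Toy.TwistedTypeNorm_1` (split at a top-level declaration boundary by port_pkg.py; scope re-opened below; declarations unchanged). -/

-- port_pkg: scope re-opened for this part (file-level context, then the namespace/section stack open at the cut)
noncomputable section
open Polynomial IntermediateField
namespace HodgeCM.Toy
attribute [local instance] Classical.propDecidable
namespace Obj
variable (X : Obj)
/-- `∏_j ev (tnorm α) (g j) = ∏_δ (δ α) ^ cntTw δ g` -/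
theorem prod_ev_tnorm (α : X.N) {k : ℕ} (g : Fin k → X.Idx) :
    ∏ j, X.ev (X.tnorm α) (g j) = ∏ δ : X.G, ((δ α : X.N) : ℂ) ^ X.cntTw δ g := by
  simp only [ev_tnorm]
  have h1 : ∀ j : Fin k, ∏ δ ∈ Finset.univ.filter (fun δ : X.G => X.holTw δ (g j)), ((δ α : X.N) : ℂ)
      = ∏ δ : X.G, (if X.holTw δ (g j) then ((δ α : X.N) : ℂ) else 1) :=
    fun j => Finset.prod_filter _ _
  rw [Finset.prod_congr rfl (fun j _ => h1 j), Finset.prod_comm]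
  refine Finset.prod_congr rfl (fun δ _ => ?_)
  rw [← Finset.prod_filter, Finset.prod_const, cntTw]

/-! ### §7 The total eigenvalue is a power of the (rational) norm -/

/-- (Ported verbatim from the HodgeCMPerL package; no docstring in the source.) -/
theorem prod_gal_apply (α : X.N) : ∏ δ : X.G, ((δ α : X.N) : ℂ) = ((Algebra.norm ℚ α : ℚ) : ℂ) := by
  have h := Algebra.norm_eq_prod_automorphisms ℚ α
  have h2 : ((algebraMap ℚ X.N (Algebra.norm ℚ α) : X.N) : ℂ) = ((Algebra.norm ℚ α : ℚ) : ℂ) := by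
    rw [coe_eq_algebraMap, ← IsScalarTower.algebraMap_apply, eq_ratCast]
  rw [← h2, h, coe_eq_algebraMap, map_prod]
  rfl

/-- (Ported verbatim from the HodgeCMPerL package; no docstring in the source.) -/
theorem prod_ev_tnorm_of_cntTw (α : X.N) {k d : ℕ} (g : Fin k → X.Idx) (hg : ∀ δ, X.cntTw δ g = d) :
    ∏ j, X.ev (X.tnorm α) (g j) = ((Algebra.norm ℚ α : ℚ) : ℂ) ^ d := by
  rw [prod_ev_tnorm, ← prod_gal_apply, ← Finset.prod_pow]
  exact Finset.prod_congr rfl (fun δ _ => by rw [hg δ])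

/-! ### §8 `tnorm α` is invertible for `α ≠ 0` -/

/-- (Ported verbatim from the HodgeCMPerL package; no docstring in the source.) -/
lemma normStab_ne_zero {α : X.N} (hα : α ≠ 0) (i : X.s.toType) (φ : (X.atom i).F →+* ℂ) :
    X.normStab i φ α ≠ 0 := by
  rw [normStab, Finset.prod_ne_zero_iff]
  intro h _
  exact (map_ne_zero_iff _ h.injective).mpr hα

/-- (Ported verbatim from the HodgeCMPerL package; no docstring in the source.) -/
lemma tnormAt_ne_zero {α : X.N} (hα : α ≠ 0) (i : X.s.toType) (φ : (X.atom i).F →+* ℂ) :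
    X.tnormAt i φ α ≠ 0 := by
  intro h
  apply X.normStab_ne_zero hα i φ
  rw [← toN_tnormAt, h, map_zero]

/-- (Ported verbatim from the HodgeCMPerL package; no docstring in the source.) -/
lemma tnorm_ne_zero {α : X.N} (hα : α ≠ 0) (i : X.s.toType) : X.tnorm α i ≠ 0 := by
  rw [tnorm, Finset.prod_ne_zero_iff]
  exact fun φ _ => X.tnormAt_ne_zero hα i φ

/-- coordinatewise multiplication by `g` with all `g i ≠ 0`, as a linear automorphism of `L X` -/
def mulLEquiv (g : X.L) (hg : ∀ i, g i ≠ 0) : X.L ≃ₗ[ℚ] X.L :=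
  LinearEquiv.ofLinear (X.mulL g) (X.mulL fun i => (g i)⁻¹)
    (by rw [← mulL_mul, ← mulL_one]; congr 1; funext i; exact mul_inv_cancel₀ (hg i))
    (by rw [← mulL_mul, ← mulL_one]; congr 1; funext i; exact inv_mul_cancel₀ (hg i))

/-- (Ported verbatim from the HodgeCMPerL package; no docstring in the source.) -/
@[simp] lemma coe_mulLEquiv (g : X.L) (hg : ∀ i, g i ≠ 0) :
    (X.mulLEquiv g hg : X.L →ₗ[ℚ] X.L) = X.mulL g := rfl

end Obj

end HodgeCM.Toy

-- port_pkg: scope closed for this part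
end
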